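import Summits.CriticalPhenomena.PercolationContinuityZ3.Theorems.PercNearOneGluingNoHeavyQuantTwoBlobTopFlippedLightSharpFloor
import Summits.CriticalPhenomena.PercolationContinuityZ3.Theorems.PercNearOneGluingNoHeavyQuantLightSliceAssembly
import HarnessLib

/-!
# QUANT lane R8, T-DEC, binder (II): THE TOP-FLIPPED LIGHT PIECES AT THE SHARP FLOOR in cell coordinates, and `LightSliceWide` for floors
# `x ≥ x*` (part 5 of the exact-floor-threshold row)

builds on p205010 (kernel theorem, internal audit signed; external expert review pending)

Support file (`--supports stmt-CriticalPhenomena-4575`), QUANT lane seat prim-quant-arm-2 (gen 32), rung R8 of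
`run/shared/lean/prim/quant/LADDER.md`.  Theorems only, standard axioms, no sorries, no definitions.
* `LawDec.twoBlobShift_topFlipped_light{Heavy,Light}_decAtT_of_sharpFloor`, `…PairPiece_decAtT_of_sharpFloor`,
  `shift_…Pairs_decAtT_of_sharpFloor`, `lconv_light{Heavy,Light}Pairs_decAtT_of_sharpFloor` — arm-2 g31's shifted / cell-coordinate /
  `SH`-mixture / `lconv` forms of the top-flipped light pieces with the aspect hypotheses REPLACED by the sharp floor `1 ≤ x³ + x² + 3x`
  (part 3, `…TwoBlobTopFlippedLightSharpFloor`).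
* `LawDec.pieceC_decAtT_topGiant_of_sharpFloor` — census-2 g59's piece C lemma (`…QuantLightSlicePieces`) without the aspect bound at the
  sharp floor.
* **`LawDec.lightSliceWide_of_sharpFloor`** — the pooled residual statement `LawDec.LightSliceWide` of (II) (`…QuantLightSliceResidual`,
  `@[conjecture]`) HOLDS at every floor with `1 ≤ x³ + x² + 3x` (x ≥ x* = 0.29559…), piece-wise; and
  **`LawDec.lightSliceCore_of_lowCross_of_sharpFloor`** — at those floors the light-slice core (statement of record (II), V295/V297) follows
  from `LightSliceLowCross` ALONE.  Below x* the class is genuinely pooled (`…SharpFloorWitnesses`).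
HONEST: `LightSliceLowCross`, `LightSliceWide` (floors `x < x*`) and (III) remain OPEN; RATE class log* / honest sentence unchanged.

[this work]; the (II) assembly `…QuantLightSliceAssembly` / pieces `…QuantLightSlicePieces` / residue `…QuantLightSliceResidual` (census-2
g58/g59), the piece anatomy FOR-PROVERS-CONV-PIECES (lead g26) — this lane.  Nothing here is cited as a published result.  The gluing rows
served [cite: KozmaNitzan2024, Conjecture 3 (p. 15)]; product measure [cite: Grimmett1999, §1.3 p. 10].
-/

noncomputable section

namespace Summit.CriticalPhenomena.PercolationContinuityZ3.Theorems

namespace Quant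

open Finset

/-- the two-point law `{lo, hi; g}` (as in `…QuantLawDEC`) -/
local notation3 "TP[" lo ", " hi ", " g ", " h "]" =>
  (g : ℝ) * (if (h : ℕ) = (hi : ℕ) then (1 : ℝ) else 0) + (1 - (g : ℝ)) * (if (h : ℕ) = (lo : ℕ) then (1 : ℝ) else 0)

/-- the law `μ` shifted up by `s` (as in `…QuantConvHeavy`) -/
local notation3 "SH[" μ ", " s ", " h "]" => (if (s : ℕ) ≤ (h : ℕ) then (μ : ℕ → ℝ) ((h : ℕ) - (s : ℕ)) else (0 : ℝ))

/-- the two-blob law `(1−u)(1−v)δ₀ + u(1−v)δ_a + (1−u)vδ_b + uvδ_{a+b}` evaluated at `h` (as in `…QuantBlobDecTwoLawParts`) -/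
local notation3 "LAW2[" a ", " u ", " b ", " v ", " h "]" =>
  (1 - (u : ℝ)) * (1 - (v : ℝ)) * (if (h : ℕ) = 0 then (1 : ℝ) else 0)
    + (u : ℝ) * (1 - (v : ℝ)) * (if (h : ℕ) = (a : ℕ) then (1 : ℝ) else 0)
    + (1 - (u : ℝ)) * (v : ℝ) * (if (h : ℕ) = (b : ℕ) then (1 : ℝ) else 0)
    + (u : ℝ) * (v : ℝ) * (if (h : ℕ) = (a : ℕ) + (b : ℕ) then (1 : ℝ) else 0)

namespace LawDec

/-! ### Light–heavy, sharp floor: shifted, cell coordinates, `SH`, `lconv` -/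

/-- **THE TOP-FLIPPED LIGHTHEAVY PIECE, SHIFTED**: shift `s`, any top `M ≥ s + A + B`, any target `T′ ≤ 2s + c`; cross atoms mids
(`s + A, s + B ≤ j`, `c ≤ 2A`, `c ≤ 2B`), top a giant (`j + 1 ≤ s + A + B`). (sharp floor `1 ≤ x³ + x² + 3x`, every aspect ratio). [this work] -/
theorem twoBlobShift_topFlipped_lightHeavy_decAtT_of_sharpFloor (x γ g T' : ℝ) (s A B j M : ℕ) (hx0 : 0 < x) (hx1 : x < 1)
    (hγ0 : x ^ 2 < γ) (hγx : γ < x) (hxg : x ≤ g) (hg1 : g ≤ 1) (hA : 1 ≤ A) (hB : 1 ≤ B) (hxS : 1 ≤ x ^ 3 + x ^ 2 + 3 * x)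
    (hAj : s + A ≤ j) (hBj : s + B ≤ j) (hj : j + 1 ≤ s + A + B) (hM : s + A + B ≤ M)
    (hcA : (A : ℝ) * ((γ - x ^ 2) / (1 - x)) + (B : ℝ) * g ≤ 2 * (A : ℝ)) (hcB : (A : ℝ) * ((γ - x ^ 2) / (1 - x)) + (B : ℝ) * g ≤ 2 * (B : ℝ))
    (hT' : T' ≤ 2 * (s : ℝ) + ((A : ℝ) * ((γ - x ^ 2) / (1 - x)) + (B : ℝ) * g)) :
    DECAtT x T' j M (fun h => if s ≤ h then LAW2[A, γ, B, g, h - s] else 0) := by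
  classical
  have hdec := twoBlob_topFlipped_lightHeavy_decAtT_of_sharpFloor x γ g A B (j - s) hx0 hx1 hγ0 hγx hxg hg1 hA hB hxS
    (by omega) (by omega) (by omega) hcA hcB
  have hsh := decAtT_shift_two x _ (j - s) (A + B) s _ hdec
  rw [show j - s + s = j by omega] at hsh
  exact decAtT_antitone_target (by linarith) (decAtT_mono_top hsh (by omega))

/-- **THE TOP-FLIPPED LIGHTHEAVY PIECE in cell coordinates**: cells `{lo₁, hi₁; γ}` and `{lo₂, hi₂; g}` (`lo_i < hi_i`), the four-atom
piece `(1−γ)(1−g)δ_{lo₁+lo₂} + γ(1−g)δ_{hi₁+lo₂} + (1−γ)gδ_{lo₁+hi₂} + γgδ_{hi₁+hi₂}` is `DECAtT x T′ j′ M` for every `M ≥ hi₁ + hi₂` and every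
`T′ ≤` the sum of the two (N)-credits, at a layer where the cross atoms are mids and the top atom is a giant. (sharp floor `1 ≤ x³ + x² + 3x`, every aspect ratio). [this work] -/
theorem lightHeavyPairPiece_decAtT_of_sharpFloor (x T' γ g : ℝ) (j' M lo₁ hi₁ lo₂ hi₂ : ℕ) (hx0 : 0 < x) (hx1 : x < 1)
    (hxγ : x ^ 2 < γ) (hγx : γ < x) (hxg : x ≤ g) (hg1 : g ≤ 1) (h₁ : lo₁ < hi₁) (h₂ : lo₂ < hi₂) (hxS : 1 ≤ x ^ 3 + x ^ 2 + 3 * x)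
    (hM : hi₁ + hi₂ ≤ M) (hj1 : hi₁ + lo₂ ≤ j') (hj2 : lo₁ + hi₂ ≤ j') (hj : j' + 1 ≤ hi₁ + hi₂)
    (hcA : ((hi₁ : ℝ) - lo₁) * ((γ - x ^ 2) / (1 - x)) + ((hi₂ : ℝ) - lo₂) * g ≤ 2 * ((hi₁ : ℝ) - lo₁))
    (hcB : ((hi₁ : ℝ) - lo₁) * ((γ - x ^ 2) / (1 - x)) + ((hi₂ : ℝ) - lo₂) * g ≤ 2 * ((hi₂ : ℝ) - lo₂))
    (hT' : T' ≤ 2 * (lo₁ : ℝ) + ((hi₁ : ℝ) - lo₁) * ((γ - x ^ 2) / (1 - x)) + (2 * (lo₂ : ℝ) + ((hi₂ : ℝ) - lo₂) * g)) :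
    DECAtT x T' j' M (fun h => (1 - γ) * (1 - g) * (if h = lo₁ + lo₂ then (1 : ℝ) else 0)
      + γ * (1 - g) * (if h = hi₁ + lo₂ then (1 : ℝ) else 0)
      + (1 - γ) * g * (if h = lo₁ + hi₂ then (1 : ℝ) else 0)
      + γ * g * (if h = hi₁ + hi₂ then (1 : ℝ) else 0)) := by
  classical
  obtain ⟨A, hA⟩ : ∃ A, hi₁ = lo₁ + A := ⟨hi₁ - lo₁, by omega⟩
  obtain ⟨B, hB⟩ : ∃ B, hi₂ = lo₂ + B := ⟨hi₂ - lo₂, by omega⟩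
  have e1 : ((hi₁ : ℝ) - lo₁) = A := by rw [hA]; push_cast; ring
  have e2 : ((hi₂ : ℝ) - lo₂) = B := by rw [hB]; push_cast; ring
  rw [e1, e2] at hT' hcA hcB
  have hmain := twoBlobShift_topFlipped_lightHeavy_decAtT_of_sharpFloor x γ g T' (lo₁ + lo₂) A B j' M hx0 hx1 hxγ hγx hxg hg1 (by omega) (by omega)
    hxS (by omega) (by omega) (by omega) (by omega) hcA hcB (by push_cast; linarith)
  have e : (fun h => if lo₁ + lo₂ ≤ h then LAW2[A, γ, B, g, h - (lo₁ + lo₂)] else 0)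
      = fun h => (1 - γ) * (1 - g) * (if h = lo₁ + lo₂ then (1 : ℝ) else 0)
          + γ * (1 - g) * (if h = hi₁ + lo₂ then (1 : ℝ) else 0)
          + (1 - γ) * g * (if h = lo₁ + hi₂ then (1 : ℝ) else 0)
          + γ * g * (if h = hi₁ + hi₂ then (1 : ℝ) else 0) := by
    funext h
    by_cases hs : lo₁ + lo₂ ≤ h
    · rw [if_pos hs]
      have e0 : (h - (lo₁ + lo₂) = 0) ↔ (h = lo₁ + lo₂) := by omega
      have eA : (h - (lo₁ + lo₂) = A) ↔ (h = hi₁ + lo₂) := by omega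
      have eB : (h - (lo₁ + lo₂) = B) ↔ (h = lo₁ + hi₂) := by omega
      have eAB : (h - (lo₁ + lo₂) = A + B) ↔ (h = hi₁ + hi₂) := by omega
      simp only [e0, eA, eB, eAB]
    · rw [if_neg hs, if_neg (by omega), if_neg (by omega), if_neg (by omega), if_neg (by omega)]
      ring
  rw [e] at hmain
  exact hmain

/-- **THE TOP-FLIPPED LIGHTHEAVY PIECE in the `SH`-mixture form of `lconv_TP`**: `(1−g)·shift_{lo₂}{lo₁, hi₁; γ} + g·shift_{hi₂}{lo₁, hi₁; γ}`. (sharp floor `1 ≤ x³ + x² + 3x`, every aspect ratio). [this work] -/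
theorem shift_lightHeavyPairs_decAtT_of_sharpFloor (x T' γ g : ℝ) (j' M lo₁ hi₁ lo₂ hi₂ : ℕ) (hx0 : 0 < x) (hx1 : x < 1)
    (hxγ : x ^ 2 < γ) (hγx : γ < x) (hxg : x ≤ g) (hg1 : g ≤ 1) (h₁ : lo₁ < hi₁) (h₂ : lo₂ < hi₂) (hxS : 1 ≤ x ^ 3 + x ^ 2 + 3 * x)
    (hM : hi₁ + hi₂ ≤ M) (hj1 : hi₁ + lo₂ ≤ j') (hj2 : lo₁ + hi₂ ≤ j') (hj : j' + 1 ≤ hi₁ + hi₂)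
    (hcA : ((hi₁ : ℝ) - lo₁) * ((γ - x ^ 2) / (1 - x)) + ((hi₂ : ℝ) - lo₂) * g ≤ 2 * ((hi₁ : ℝ) - lo₁))
    (hcB : ((hi₁ : ℝ) - lo₁) * ((γ - x ^ 2) / (1 - x)) + ((hi₂ : ℝ) - lo₂) * g ≤ 2 * ((hi₂ : ℝ) - lo₂))
    (hT' : T' ≤ 2 * (lo₁ : ℝ) + ((hi₁ : ℝ) - lo₁) * ((γ - x ^ 2) / (1 - x)) + (2 * (lo₂ : ℝ) + ((hi₂ : ℝ) - lo₂) * g)) :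
    DECAtT x T' j' M
      (fun h => (1 - g) * SH[(fun t => TP[lo₁, hi₁, γ, t]), lo₂, h] + g * SH[(fun t => TP[lo₁, hi₁, γ, t]), hi₂, h]) := by
  have e : (fun h => (1 - g) * SH[(fun t => TP[lo₁, hi₁, γ, t]), lo₂, h] + g * SH[(fun t => TP[lo₁, hi₁, γ, t]), hi₂, h])
      = fun h => (1 - γ) * (1 - g) * (if h = lo₁ + lo₂ then (1 : ℝ) else 0)
          + γ * (1 - g) * (if h = hi₁ + lo₂ then (1 : ℝ) else 0)
          + (1 - γ) * g * (if h = lo₁ + hi₂ then (1 : ℝ) else 0)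
          + γ * g * (if h = hi₁ + hi₂ then (1 : ℝ) else 0) :=
    funext fun h => shift_TP_pair_eq γ g lo₁ hi₁ lo₂ hi₂ h h₂.le
  rw [e]
  exact lightHeavyPairPiece_decAtT_of_sharpFloor x T' γ g j' M lo₁ hi₁ lo₂ hi₂ hx0 hx1 hxγ hγx hxg hg1 h₁ h₂ hxS hM hj1 hj2 hj hcA hcB hT'

/-- **THE TOP-FLIPPED LIGHTHEAVY PIECE as a convolution of two cells** (census-2 g53's `LawDec.lconv`): for cells `{lo₁, hi₁; γ}` on `{0..M₁}`
and `{lo₂, hi₂; g}` on `{0..M₂}`. (sharp floor `1 ≤ x³ + x² + 3x`, every aspect ratio). [this work] -/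
theorem lconv_lightHeavyPairs_decAtT_of_sharpFloor (x T' γ g : ℝ) (j' M₁ M₂ lo₁ hi₁ lo₂ hi₂ : ℕ) (hx0 : 0 < x) (hx1 : x < 1)
    (hxγ : x ^ 2 < γ) (hγx : γ < x) (hxg : x ≤ g) (hg1 : g ≤ 1) (h₁ : lo₁ < hi₁) (hM₁ : hi₁ ≤ M₁) (h₂ : lo₂ < hi₂) (hM₂ : hi₂ ≤ M₂) (hxS : 1 ≤ x ^ 3 + x ^ 2 + 3 * x)
    (hj1 : hi₁ + lo₂ ≤ j') (hj2 : lo₁ + hi₂ ≤ j') (hj : j' + 1 ≤ hi₁ + hi₂)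
    (hcA : ((hi₁ : ℝ) - lo₁) * ((γ - x ^ 2) / (1 - x)) + ((hi₂ : ℝ) - lo₂) * g ≤ 2 * ((hi₁ : ℝ) - lo₁))
    (hcB : ((hi₁ : ℝ) - lo₁) * ((γ - x ^ 2) / (1 - x)) + ((hi₂ : ℝ) - lo₂) * g ≤ 2 * ((hi₂ : ℝ) - lo₂))
    (hT' : T' ≤ 2 * (lo₁ : ℝ) + ((hi₁ : ℝ) - lo₁) * ((γ - x ^ 2) / (1 - x)) + (2 * (lo₂ : ℝ) + ((hi₂ : ℝ) - lo₂) * g)) :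
    DECAtT x T' j' (M₁ + M₂) (lconv M₁ M₂ (fun t => TP[lo₁, hi₁, γ, t]) (fun t => TP[lo₂, hi₂, g, t])) := by
  have e : lconv M₁ M₂ (fun t => TP[lo₁, hi₁, γ, t]) (fun t => TP[lo₂, hi₂, g, t])
      = fun h => (1 - g) * SH[(fun t => TP[lo₁, hi₁, γ, t]), lo₂, h] + g * SH[(fun t => TP[lo₁, hi₁, γ, t]), hi₂, h] :=
    funext fun h => lconv_TP M₁ M₂ lo₂ hi₂ (fun t => TP[lo₁, hi₁, γ, t]) g
      (fun t ht => TP_eq_zero_of_top_lt lo₁ hi₁ M₁ γ h₁.le hM₁ t ht) (h₂.le.trans hM₂) hM₂ h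
  rw [e]
  exact shift_lightHeavyPairs_decAtT_of_sharpFloor x T' γ g j' (M₁ + M₂) lo₁ hi₁ lo₂ hi₂ hx0 hx1 hxγ hγx hxg hg1 h₁ h₂ hxS (by omega) hj1 hj2 hj hcA hcB hT'

/-! ### Light–light, sharp floor: shifted, cell coordinates, `SH`, `lconv` -/

/-- **THE TOP-FLIPPED LIGHTLIGHT PIECE, SHIFTED**: shift `s`, any top `M ≥ s + A + B`, any target `T′ ≤ 2s + c`; cross atoms mids
(`s + A, s + B ≤ j`, `c ≤ 2A`, `c ≤ 2B`), top a giant (`j + 1 ≤ s + A + B`). (sharp floor `1 ≤ x³ + x² + 3x`, every aspect ratio). [this work] -/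
theorem twoBlobShift_topFlipped_lightLight_decAtT_of_sharpFloor (x γ g T' : ℝ) (s A B j M : ℕ) (hx0 : 0 < x) (hx1 : x < 1)
    (h1 : x ^ 2 < γ) (h1x' : γ < x) (h2 : x ^ 2 < g) (h2x : g < x) (hA : 1 ≤ A) (hB : 1 ≤ B) (hxS : 1 ≤ x ^ 3 + x ^ 2 + 3 * x)
    (hAj : s + A ≤ j) (hBj : s + B ≤ j) (hj : j + 1 ≤ s + A + B) (hM : s + A + B ≤ M)
    (hcA : (A : ℝ) * ((γ - x ^ 2) / (1 - x)) + (B : ℝ) * ((g - x ^ 2) / (1 - x)) ≤ 2 * (A : ℝ)) (hcB : (A : ℝ) * ((γ - x ^ 2) / (1 - x)) + (B : ℝ) * ((g - x ^ 2) / (1 - x)) ≤ 2 * (B : ℝ))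
    (hT' : T' ≤ 2 * (s : ℝ) + ((A : ℝ) * ((γ - x ^ 2) / (1 - x)) + (B : ℝ) * ((g - x ^ 2) / (1 - x)))) :
    DECAtT x T' j M (fun h => if s ≤ h then LAW2[A, γ, B, g, h - s] else 0) := by
  classical
  have hdec := twoBlob_topFlipped_lightLight_decAtT_of_sharpFloor x γ g A B (j - s) hx0 hx1 h1 h1x' h2 h2x hA hB hxS
    (by omega) (by omega) (by omega) hcA hcB
  have hsh := decAtT_shift_two x _ (j - s) (A + B) s _ hdec
  rw [show j - s + s = j by omega] at hsh
  exact decAtT_antitone_target (by linarith) (decAtT_mono_top hsh (by omega))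

/-- **THE TOP-FLIPPED LIGHTLIGHT PIECE in cell coordinates**: cells `{lo₁, hi₁; γ}` and `{lo₂, hi₂; g}` (`lo_i < hi_i`), the four-atom
piece `(1−γ)(1−g)δ_{lo₁+lo₂} + γ(1−g)δ_{hi₁+lo₂} + (1−γ)gδ_{lo₁+hi₂} + γgδ_{hi₁+hi₂}` is `DECAtT x T′ j′ M` for every `M ≥ hi₁ + hi₂` and every
`T′ ≤` the sum of the two (N)-credits, at a layer where the cross atoms are mids and the top atom is a giant. (sharp floor `1 ≤ x³ + x² + 3x`, every aspect ratio). [this work] -/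
theorem lightLightPairPiece_decAtT_of_sharpFloor (x T' γ g : ℝ) (j' M lo₁ hi₁ lo₂ hi₂ : ℕ) (hx0 : 0 < x) (hx1 : x < 1)
    (hxγ : x ^ 2 < γ) (hγx : γ < x) (hxg : x ^ 2 < g) (hgx : g < x) (h₁ : lo₁ < hi₁) (h₂ : lo₂ < hi₂) (hxS : 1 ≤ x ^ 3 + x ^ 2 + 3 * x)
    (hM : hi₁ + hi₂ ≤ M) (hj1 : hi₁ + lo₂ ≤ j') (hj2 : lo₁ + hi₂ ≤ j') (hj : j' + 1 ≤ hi₁ + hi₂)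
    (hcA : ((hi₁ : ℝ) - lo₁) * ((γ - x ^ 2) / (1 - x)) + ((hi₂ : ℝ) - lo₂) * ((g - x ^ 2) / (1 - x)) ≤ 2 * ((hi₁ : ℝ) - lo₁))
    (hcB : ((hi₁ : ℝ) - lo₁) * ((γ - x ^ 2) / (1 - x)) + ((hi₂ : ℝ) - lo₂) * ((g - x ^ 2) / (1 - x)) ≤ 2 * ((hi₂ : ℝ) - lo₂))
    (hT' : T' ≤ 2 * (lo₁ : ℝ) + ((hi₁ : ℝ) - lo₁) * ((γ - x ^ 2) / (1 - x)) + (2 * (lo₂ : ℝ) + ((hi₂ : ℝ) - lo₂) * ((g - x ^ 2) / (1 - x)))) :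
    DECAtT x T' j' M (fun h => (1 - γ) * (1 - g) * (if h = lo₁ + lo₂ then (1 : ℝ) else 0)
      + γ * (1 - g) * (if h = hi₁ + lo₂ then (1 : ℝ) else 0)
      + (1 - γ) * g * (if h = lo₁ + hi₂ then (1 : ℝ) else 0)
      + γ * g * (if h = hi₁ + hi₂ then (1 : ℝ) else 0)) := by
  classical
  obtain ⟨A, hA⟩ : ∃ A, hi₁ = lo₁ + A := ⟨hi₁ - lo₁, by omega⟩
  obtain ⟨B, hB⟩ : ∃ B, hi₂ = lo₂ + B := ⟨hi₂ - lo₂, by omega⟩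
  have e1 : ((hi₁ : ℝ) - lo₁) = A := by rw [hA]; push_cast; ring
  have e2 : ((hi₂ : ℝ) - lo₂) = B := by rw [hB]; push_cast; ring
  rw [e1, e2] at hT' hcA hcB
  have hmain := twoBlobShift_topFlipped_lightLight_decAtT_of_sharpFloor x γ g T' (lo₁ + lo₂) A B j' M hx0 hx1 hxγ hγx hxg hgx (by omega) (by omega)
    hxS (by omega) (by omega) (by omega) (by omega) hcA hcB (by push_cast; linarith)
  have e : (fun h => if lo₁ + lo₂ ≤ h then LAW2[A, γ, B, g, h - (lo₁ + lo₂)] else 0)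
      = fun h => (1 - γ) * (1 - g) * (if h = lo₁ + lo₂ then (1 : ℝ) else 0)
          + γ * (1 - g) * (if h = hi₁ + lo₂ then (1 : ℝ) else 0)
          + (1 - γ) * g * (if h = lo₁ + hi₂ then (1 : ℝ) else 0)
          + γ * g * (if h = hi₁ + hi₂ then (1 : ℝ) else 0) := by
    funext h
    by_cases hs : lo₁ + lo₂ ≤ h
    · rw [if_pos hs]
      have e0 : (h - (lo₁ + lo₂) = 0) ↔ (h = lo₁ + lo₂) := by omega
      have eA : (h - (lo₁ + lo₂) = A) ↔ (h = hi₁ + lo₂) := by omega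
      have eB : (h - (lo₁ + lo₂) = B) ↔ (h = lo₁ + hi₂) := by omega
      have eAB : (h - (lo₁ + lo₂) = A + B) ↔ (h = hi₁ + hi₂) := by omega
      simp only [e0, eA, eB, eAB]
    · rw [if_neg hs, if_neg (by omega), if_neg (by omega), if_neg (by omega), if_neg (by omega)]
      ring
  rw [e] at hmain
  exact hmain

/-- **THE TOP-FLIPPED LIGHTLIGHT PIECE in the `SH`-mixture form of `lconv_TP`**: `(1−g)·shift_{lo₂}{lo₁, hi₁; γ} + g·shift_{hi₂}{lo₁, hi₁; γ}`. (sharp floor `1 ≤ x³ + x² + 3x`, every aspect ratio). [this work] -/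
theorem shift_lightLightPairs_decAtT_of_sharpFloor (x T' γ g : ℝ) (j' M lo₁ hi₁ lo₂ hi₂ : ℕ) (hx0 : 0 < x) (hx1 : x < 1)
    (hxγ : x ^ 2 < γ) (hγx : γ < x) (hxg : x ^ 2 < g) (hgx : g < x) (h₁ : lo₁ < hi₁) (h₂ : lo₂ < hi₂) (hxS : 1 ≤ x ^ 3 + x ^ 2 + 3 * x)
    (hM : hi₁ + hi₂ ≤ M) (hj1 : hi₁ + lo₂ ≤ j') (hj2 : lo₁ + hi₂ ≤ j') (hj : j' + 1 ≤ hi₁ + hi₂)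
    (hcA : ((hi₁ : ℝ) - lo₁) * ((γ - x ^ 2) / (1 - x)) + ((hi₂ : ℝ) - lo₂) * ((g - x ^ 2) / (1 - x)) ≤ 2 * ((hi₁ : ℝ) - lo₁))
    (hcB : ((hi₁ : ℝ) - lo₁) * ((γ - x ^ 2) / (1 - x)) + ((hi₂ : ℝ) - lo₂) * ((g - x ^ 2) / (1 - x)) ≤ 2 * ((hi₂ : ℝ) - lo₂))
    (hT' : T' ≤ 2 * (lo₁ : ℝ) + ((hi₁ : ℝ) - lo₁) * ((γ - x ^ 2) / (1 - x)) + (2 * (lo₂ : ℝ) + ((hi₂ : ℝ) - lo₂) * ((g - x ^ 2) / (1 - x)))) :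
    DECAtT x T' j' M
      (fun h => (1 - g) * SH[(fun t => TP[lo₁, hi₁, γ, t]), lo₂, h] + g * SH[(fun t => TP[lo₁, hi₁, γ, t]), hi₂, h]) := by
  have e : (fun h => (1 - g) * SH[(fun t => TP[lo₁, hi₁, γ, t]), lo₂, h] + g * SH[(fun t => TP[lo₁, hi₁, γ, t]), hi₂, h])
      = fun h => (1 - γ) * (1 - g) * (if h = lo₁ + lo₂ then (1 : ℝ) else 0)
          + γ * (1 - g) * (if h = hi₁ + lo₂ then (1 : ℝ) else 0)
          + (1 - γ) * g * (if h = lo₁ + hi₂ then (1 : ℝ) else 0)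
          + γ * g * (if h = hi₁ + hi₂ then (1 : ℝ) else 0) :=
    funext fun h => shift_TP_pair_eq γ g lo₁ hi₁ lo₂ hi₂ h h₂.le
  rw [e]
  exact lightLightPairPiece_decAtT_of_sharpFloor x T' γ g j' M lo₁ hi₁ lo₂ hi₂ hx0 hx1 hxγ hγx hxg hgx h₁ h₂ hxS hM hj1 hj2 hj hcA hcB hT'

/-- **THE TOP-FLIPPED LIGHTLIGHT PIECE as a convolution of two cells** (census-2 g53's `LawDec.lconv`): for cells `{lo₁, hi₁; γ}` on `{0..M₁}`
and `{lo₂, hi₂; g}` on `{0..M₂}`. (sharp floor `1 ≤ x³ + x² + 3x`, every aspect ratio). [this work] -/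
theorem lconv_lightLightPairs_decAtT_of_sharpFloor (x T' γ g : ℝ) (j' M₁ M₂ lo₁ hi₁ lo₂ hi₂ : ℕ) (hx0 : 0 < x) (hx1 : x < 1)
    (hxγ : x ^ 2 < γ) (hγx : γ < x) (hxg : x ^ 2 < g) (hgx : g < x) (h₁ : lo₁ < hi₁) (hM₁ : hi₁ ≤ M₁) (h₂ : lo₂ < hi₂) (hM₂ : hi₂ ≤ M₂) (hxS : 1 ≤ x ^ 3 + x ^ 2 + 3 * x)
    (hj1 : hi₁ + lo₂ ≤ j') (hj2 : lo₁ + hi₂ ≤ j') (hj : j' + 1 ≤ hi₁ + hi₂)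
    (hcA : ((hi₁ : ℝ) - lo₁) * ((γ - x ^ 2) / (1 - x)) + ((hi₂ : ℝ) - lo₂) * ((g - x ^ 2) / (1 - x)) ≤ 2 * ((hi₁ : ℝ) - lo₁))
    (hcB : ((hi₁ : ℝ) - lo₁) * ((γ - x ^ 2) / (1 - x)) + ((hi₂ : ℝ) - lo₂) * ((g - x ^ 2) / (1 - x)) ≤ 2 * ((hi₂ : ℝ) - lo₂))
    (hT' : T' ≤ 2 * (lo₁ : ℝ) + ((hi₁ : ℝ) - lo₁) * ((γ - x ^ 2) / (1 - x)) + (2 * (lo₂ : ℝ) + ((hi₂ : ℝ) - lo₂) * ((g - x ^ 2) / (1 - x)))) :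
    DECAtT x T' j' (M₁ + M₂) (lconv M₁ M₂ (fun t => TP[lo₁, hi₁, γ, t]) (fun t => TP[lo₂, hi₂, g, t])) := by
  have e : lconv M₁ M₂ (fun t => TP[lo₁, hi₁, γ, t]) (fun t => TP[lo₂, hi₂, g, t])
      = fun h => (1 - g) * SH[(fun t => TP[lo₁, hi₁, γ, t]), lo₂, h] + g * SH[(fun t => TP[lo₁, hi₁, γ, t]), hi₂, h] :=
    funext fun h => lconv_TP M₁ M₂ lo₂ hi₂ (fun t => TP[lo₁, hi₁, γ, t]) g
      (fun t ht => TP_eq_zero_of_top_lt lo₁ hi₁ M₁ γ h₁.le hM₁ t ht) (h₂.le.trans hM₂) hM₂ h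
  rw [e]
  exact shift_lightLightPairs_decAtT_of_sharpFloor x T' γ g j' (M₁ + M₂) lo₁ hi₁ lo₂ hi₂ hx0 hx1 hxγ hγx hxg hgx h₁ h₂ hxS (by omega) hj1 hj2 hj hcA hcB hT'

/-! ### Piece C of the light slice at the sharp floor, and `LightSliceWide` for floors `x ≥ x*` -/

/-- **PIECE C (light ⊗ cheap), top-flipped, at the SHARP FLOOR** — census-2 g59's `pieceC_decAtT_topGiant` with the aspect bound
`h₂ − l₂ ≤ 4(h₁ − l₁)` (and the tie-break) REPLACED by the floor `1 ≤ x³ + x² + 3x`: for two light credit-tight cells `(l₁, h₁)` at `T₁`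
and `(l₂, h₂)` at `T₂` (minimal gates), top `h₁ + h₂` a giant, cross cells `h₁ + l₂`, `l₁ + h₂` mids (`≤ j`) and not conv-lows, the product cell law
is DEC at `(T₁ + T₂, j)`, whatever the spans. [this work] -/
theorem pieceC_decAtT_topGiant_of_sharpFloor (x T₁ T₂ : ℝ) (j M₁ M₂ l₁ h₁ l₂ h₂ : ℕ) (hx0 : 0 < x) (hx1 : x < 1)
    (hxS : 1 ≤ x ^ 3 + x ^ 2 + 3 * x)
    (hlow₁ : 2 * (l₁ : ℝ) < T₁) (hh₁ : h₁ ≤ j) (hc₁ : T₁ < (l₁ : ℝ) + h₁) (hM₁ : h₁ ≤ M₁)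
    (hlight₁ : usage x T₁ j l₁ h₁ < x / (1 - x))
    (hlow₂ : 2 * (l₂ : ℝ) < T₂) (hh₂ : h₂ ≤ j) (hc₂ : T₂ < (l₂ : ℝ) + h₂) (hM₂ : h₂ ≤ M₂)
    (hlight₂ : usage x T₂ j l₂ h₂ < x / (1 - x))
    (htop : j + 1 ≤ h₁ + h₂) (hcross₁ : h₁ + l₂ ≤ j) (hcross : l₁ + h₂ ≤ j)
    (hcA : T₁ + T₂ ≤ 2 * ((h₁ : ℝ) + l₂)) (hcB : T₁ + T₂ ≤ 2 * ((l₁ : ℝ) + h₂)) :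
    DECAtT x (T₁ + T₂) j (M₁ + M₂)
      (lconv M₁ M₂ (fun t => TP[l₁, h₁, gateOf x T₁ j l₁ h₁, t]) (fun t => TP[l₂, h₂, gateOf x T₂ j l₂ h₂, t])) := by
  classical
  have hlt₁ : l₁ < h₁ := by
    by_contra hge; push Not at hge
    have : (h₁ : ℝ) ≤ l₁ := by exact_mod_cast hge
    linarith
  have hlt₂ : l₂ < h₂ := by
    by_contra hge; push Not at hge
    have : (h₂ : ℝ) ≤ l₂ := by exact_mod_cast hge
    linarith
  set γ₁ := gateOf x T₁ j l₁ h₁ with hγ₁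
  set γ₂ := gateOf x T₂ j l₂ h₂ with hγ₂
  obtain ⟨hγ0, hγ1⟩ := gateOf_bounds x T₁ j l₁ h₁ hx0 hx1 hlow₁ hh₁ hc₁
  obtain ⟨hg0, hg1⟩ := gateOf_bounds x T₂ j l₂ h₂ hx0 hx1 hlow₂ hh₂ hc₂
  have hγx : γ₁ < x := gate_lt_of_usage_lt x T₁ j l₁ h₁ hx1 hγ1 hlight₁
  have hgx : γ₂ < x := gate_lt_of_usage_lt x T₂ j l₂ h₂ hx1 hg1 hlight₂
  have hcr₁ : ((h₁ : ℝ) - l₁) * ((γ₁ - x ^ 2) / (1 - x)) = T₁ - 2 * (l₁ : ℝ) :=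
    credit_light_eq_gateOf x T₁ j l₁ h₁ hx0 hx1 hlow₁ hh₁ hc₁ hγx
  have hcr₂ : ((h₂ : ℝ) - l₂) * ((γ₂ - x ^ 2) / (1 - x)) = T₂ - 2 * (l₂ : ℝ) :=
    credit_light_eq_gateOf x T₂ j l₂ h₂ hx0 hx1 hlow₂ hh₂ hc₂ hgx
  exact lconv_lightLightPairs_decAtT_of_sharpFloor x (T₁ + T₂) γ₁ γ₂ j M₁ M₂ l₁ h₁ l₂ h₂ hx0 hx1 hγ0 hγx hg0 hgx hlt₁ hM₁ hlt₂ hM₂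
    hxS hcross₁ hcross htop (by rw [hcr₁, hcr₂]; linarith) (by rw [hcr₁, hcr₂]; linarith)
    (by rw [hcr₁, hcr₂]; linarith)

/-- **`LightSliceWide` HOLDS AT EVERY FLOOR WITH `1 ≤ x³ + x² + 3x`** (x ≥ x* = 0.29559…): the binder of census-2 g59's pooled residual
statement `LawDec.LightSliceWide` verbatim plus the floor hypothesis, proved PIECE-WISE (piece E by `pieceE_decAtT`, piece C by
`pieceC_decAtT_topGiant_of_sharpFloor`, glued by `lightSlice_decAtT_of_pieces`).  The underscored binders are the parts of the residual
binder this proof does not need (window-DEC, `¬ BDECAtT`, the tie-break, the width itself).  Below x* the class is genuinely pooled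
(`not_decAtT_topFlipped_lightLight_fifth`). [this work] -/
theorem lightSliceWide_of_sharpFloor (x T₁ T₂ : ℝ) (M₁ M₂ j : ℕ) (l₁ h₁ l₁' h₁' l₂ h₂ l₂' h₂' : ℕ)
    (hxS : 1 ≤ x ^ 3 + x ^ 2 + 3 * x) (hx0 : 0 < x) (hx1 : x < 1) (hj : j < M₁ + M₂)
    (hd₁ : AtomData x T₁ j M₁ l₁ h₁ l₁' h₁') (hd₂ : AtomData x T₂ j M₂ l₂ h₂ l₂' h₂')
    (_ho₁ : l₁ < l₁') (_ho₂ : h₁' ≤ h₁) (ho₃ : l₂ < l₂') (ho₄ : h₂' ≤ h₂)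
    (_hw₁ : ∀ j'', j'' ≤ j → j ≤ j'' + M₂ → DECAtT x T₁ j'' M₁ (atomLaw x T₁ j l₁ h₁ l₁' h₁'))
    (_hw₂ : ∀ j'', j'' ≤ j → j ≤ j'' + M₁ → DECAtT x T₂ j'' M₂ (atomLaw x T₂ j l₂ h₂ l₂' h₂'))
    (_hb₁ : ¬ BDECAtT x T₁ j M₁ M₂ (atomLaw x T₁ j l₁ h₁ l₁' h₁')) (_hb₂ : ¬ BDECAtT x T₂ j M₂ M₁ (atomLaw x T₂ j l₂ h₂ l₂' h₂'))
    (hdeep₁ : l₁' + h₂' ≤ j) (hdeep₂ : l₂' + h₁' ≤ j)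
    (hA2 : T₁ + T₂ ≤ 2 * ((l₁' : ℝ) + h₂'))
    (htie : h₁' + l₂' ≤ h₂' + l₁')
    (htop : j + 1 ≤ h₁' + h₂')
    (hlow : T₁ + T₂ ≤ 2 * ((h₁' : ℝ) + l₂'))
    (_hwide : 4 * (h₁' - l₁') < h₂' - l₂') :
    DECAtT x (T₁ + T₂) j (M₁ + M₂)
      (lconv M₁ M₂ (fun b => TP[l₁', h₁', gateOf x T₁ j l₁' h₁', b]) (atomLaw x T₂ j l₂ h₂ l₂' h₂')) := by
  have hd₁' := hd₁
  have hd₂' := hd₂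
  obtain ⟨-, -, -, -, -, -, b2, b3, b4, b5, -, c2, -⟩ := hd₁'
  obtain ⟨-, a2', a3', a4', a5', -, b2', b3', b4', b5', -, c2', c1'⟩ := hd₂'
  obtain ⟨hlt₂, -⟩ := hd₂.lt_of
  refine lightSlice_decAtT_of_pieces x T₁ T₂ M₁ M₂ j l₁' h₁' l₂ h₂ l₂' h₂' _ hx0 hx1 hd₂ ?_ ?_
  · exact pieceE_decAtT x T₁ T₂ j M₁ M₂ l₁' h₁' l₂ h₂ hx0 hx1 hj b2 b3 b5 b4 c2 a2' a3' a5' a4' c1' (by omega) (by omega)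
      (by have : ((h₂' : ℕ) : ℝ) ≤ h₂ := by exact_mod_cast ho₄
          linarith)
  · exact pieceC_decAtT_topGiant_of_sharpFloor x T₁ T₂ j M₁ M₂ l₁' h₁' l₂' h₂' hx0 hx1 hxS b2 b3 b5 b4 c2 b2' b3' b5' b4' c2'
      htop (by omega) hdeep₁ hlow hA2

/-- **AT FLOORS `x ≥ x*` THE LIGHT-SLICE CORE FOLLOWS FROM `LightSliceLowCross` ALONE**: the binder of the statement of record (II)
`LawDec.LightSliceCore` (census-2 g58) plus `1 ≤ x³ + x² + 3x`, assuming only the low-cross residual statement — the wide residue is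
discharged by `pieceC_decAtT_topGiant_of_sharpFloor` (proof = census-2 g59's `lightSliceCore_of_residual` with the last two branches merged).
CONDITIONAL on the `@[conjecture]` `LightSliceLowCross`. [this work] -/
theorem lightSliceCore_of_lowCross_of_sharpFloor (hR₁ : LightSliceLowCross) (x T₁ T₂ : ℝ) (M₁ M₂ j : ℕ)
    (l₁ h₁ l₁' h₁' l₂ h₂ l₂' h₂' : ℕ) (hxS : 1 ≤ x ^ 3 + x ^ 2 + 3 * x)
    (hx0 : 0 < x) (hx1 : x < 1) (hj : j < M₁ + M₂)
    (hd₁ : AtomData x T₁ j M₁ l₁ h₁ l₁' h₁') (hd₂ : AtomData x T₂ j M₂ l₂ h₂ l₂' h₂')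
    (ho₁ : l₁ < l₁') (ho₂ : h₁' ≤ h₁) (ho₃ : l₂ < l₂') (ho₄ : h₂' ≤ h₂)
    (hw₁ : ∀ j'', j'' ≤ j → j ≤ j'' + M₂ → DECAtT x T₁ j'' M₁ (atomLaw x T₁ j l₁ h₁ l₁' h₁'))
    (hw₂ : ∀ j'', j'' ≤ j → j ≤ j'' + M₁ → DECAtT x T₂ j'' M₂ (atomLaw x T₂ j l₂ h₂ l₂' h₂'))
    (hb₁ : ¬ BDECAtT x T₁ j M₁ M₂ (atomLaw x T₁ j l₁ h₁ l₁' h₁')) (hb₂ : ¬ BDECAtT x T₂ j M₂ M₁ (atomLaw x T₂ j l₂ h₂ l₂' h₂'))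
    (hdeep₁ : l₁' + h₂' ≤ j) (hdeep₂ : l₂' + h₁' ≤ j)
    (hA2 : T₁ + T₂ ≤ 2 * ((l₁' : ℝ) + h₂'))
    (htie : h₁' + l₂' ≤ h₂' + l₁') :
    DECAtT x (T₁ + T₂) j (M₁ + M₂)
      (lconv M₁ M₂ (fun b => TP[l₁', h₁', gateOf x T₁ j l₁' h₁', b]) (atomLaw x T₂ j l₂ h₂ l₂' h₂')) := by
  have hd₁' := hd₁
  have hd₂' := hd₂
  obtain ⟨-, -, -, -, -, -, b2, b3, b4, b5, -, c2, -⟩ := hd₁'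
  obtain ⟨-, a2', a3', a4', a5', -, b2', b3', b4', b5', -, c2', c1'⟩ := hd₂'
  obtain ⟨hlt₂, -⟩ := hd₂.lt_of
  by_cases htop : h₁' + h₂' ≤ j
  · -- piece-wise, piece C without a giant
    refine lightSlice_decAtT_of_pieces x T₁ T₂ M₁ M₂ j l₁' h₁' l₂ h₂ l₂' h₂' _ hx0 hx1 hd₂ ?_ ?_
    · exact pieceE_decAtT x T₁ T₂ j M₁ M₂ l₁' h₁' l₂ h₂ hx0 hx1 hj b2 b3 b5 b4 c2 a2' a3' a5' a4' c1' (by omega) (by omega)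
        (by have : ((h₂' : ℕ) : ℝ) ≤ h₂ := by exact_mod_cast ho₄
            linarith)
    · exact pieceC_decAtT_noGiant x T₁ T₂ j M₁ M₂ l₁' h₁' l₂' h₂' hx0 hx1 b2 b3 b5 b4 b2' b3' b5' b4' htop
  push Not at htop
  by_cases hlow : 2 * ((h₁' : ℝ) + l₂') < T₁ + T₂
  · -- the low-cross residue
    exact hR₁ x T₁ T₂ M₁ M₂ j l₁ h₁ l₁' h₁' l₂ h₂ l₂' h₂' hx0 hx1 hj hd₁ hd₂ ho₁ ho₂ ho₃ ho₄ hw₁ hw₂ hb₁ hb₂ hdeep₁ hdeep₂ hA2 htie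
      (by omega) hlow
  push Not at hlow
  -- piece-wise, piece C top-flipped at the sharp floor: NO aspect condition
  refine lightSlice_decAtT_of_pieces x T₁ T₂ M₁ M₂ j l₁' h₁' l₂ h₂ l₂' h₂' _ hx0 hx1 hd₂ ?_ ?_
  · exact pieceE_decAtT x T₁ T₂ j M₁ M₂ l₁' h₁' l₂ h₂ hx0 hx1 hj b2 b3 b5 b4 c2 a2' a3' a5' a4' c1' (by omega) (by omega)
      (by have : ((h₂' : ℕ) : ℝ) ≤ h₂ := by exact_mod_cast ho₄
          linarith)
  · exact pieceC_decAtT_topGiant_of_sharpFloor x T₁ T₂ j M₁ M₂ l₁' h₁' l₂' h₂' hx0 hx1 hxS b2 b3 b5 b4 c2 b2' b3' b5' b4' c2'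
      (by omega) (by omega) hdeep₁ hlow hA2

end LawDec

end Quant

end Summit.CriticalPhenomena.PercolationContinuityZ3.Theorems
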